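import Literature.Geometry.PolyhedralFans.BarycentricSubdivision
import Literature.Geometry.PolyhedralFans.LinkBridge
import Literature.Geometry.PolyhedralFans.LinkedRefinement
import Literature.Geometry.PolyhedralFans.MultiStarDescent
import HarnessLib

/-!
# Orbits of parallelotope points under the links of a family of fans

Topic: `Literature/Geometry/PolyhedralFans` (block A5c "orbits" of the LINKED-KKMS programme;
continuation of `BarycentricSubdivision`, `LinkBridge` (res-lit-3), `MultiStarDescent`).
G. Kempf, F. Knudsen, D. Mumford, B. Saint-Donat, *Toroidal Embeddings I* (LNM 339, 1973),
Ch. II §2: on a conical polyhedral complex the regularisation of Ch. I §2 Thm. 11 must be performed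
at ALL images of the chosen lattice point under the chart changes at once; after the barycentric
subdivision these images are separated (no cell contains two of them), which is what makes the
simultaneous step (`MultiStarSubdivision`, `MultiStarDescent`) possible.

For a family of rational fans `Δ₀ i ⊆ ℚ^{n i}` with family links (`Fan.FamilyLink`), current
refinements `Δ i` of the flag fans (every cone inside a flag cone, covering, link-compatible in
both directions) and a primitive parallelotope point `w` of a cone of
`Δ i₀`, we construct (`Fan.exists_orbit`) finite sets `Z i` with `w ∈ Z i₀`, closed under every
link and its inverse, consisting of primitive parallelotope points of cones of `Δ i`, and
SEPARATED: no cone of `Δ i` contains two distinct points of `Z i`. Construction: `Z i` = the points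
having the FLAG TYPE of `w` (same barycentric coefficient at the chain member of each dimension),
which are primitive and parallelotope points; the three conditions are link-invariant and the type
pins a point down inside any flag cone.

* `Fan.chain_le_of_rep_mem` — a positive barycentric combination over a chain lying in a cone
  `τ` of the fan has all its chain members `≤ τ`;
* `Fan.eq_of_le_of_finrank_span_eq` — comparable cones of equal dimension are equal;
* `Fan.parPoint_face` — a parallelotope point of a simplicial cone is a parallelotope point of
  the face cut out by any cone of the fan containing it;
* `Fan.exists_orbit` — the orbit theorem (EXACTLY pv-2's A5c specification; no simpliciality of the
  members is needed: the carrying cone of a transported point is the transported face cut out by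
  a cone inside the link's source);
* `Fan.orbit_toList_closed`, `Fan.orbit_toList_separated` — the orbit, as lists `(Z i).toList`,
  satisfies verbatim the hypotheses of `Fan.familyLinkCompatible_starIter` (res-lit-3) and of the
  multi-point lemmas.

References: [KempfEtAl1973] Ch. II §1 Def. 5, §2 Thm. 11*; [Fulton1993Toric] §2.6 p. 48.
-/

noncomputable section

namespace Literature.Geometry.PolyhedralFans

open PointedCone Finset

namespace Fan

variable {κ : Type*}

/-! ## Positive barycentric combinations over a chain -/

/-- A positive barycentric combination over a nonempty chain of cones of a rational fan lies in
its top cone and in no proper face of it. [cite: KempfEtAl1973, II §2] -/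
theorem rep_mem_top_noProperFace {Δ : Fan ℚ (κ → ℚ)} (hΔ : Δ.IsRational)
    {Φ : Finset (PointedCone ℚ (κ → ℚ))} (hΦ : (↑Φ : Set (PointedCone ℚ (κ → ℚ))) ⊆ Δ.cones)
    (hch : IsChain (· ≤ ·) (Φ : Set (PointedCone ℚ (κ → ℚ)))) {lam : PointedCone ℚ (κ → ℚ) → ℚ}
    (hlam : ∀ φ ∈ Φ, 0 < lam φ) {μ : PointedCone ℚ (κ → ℚ)} (hμ : Maximal (· ∈ Φ) μ) :
    (∑ φ ∈ Φ, lam φ • bary φ) ∈ μ ∧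
      ∀ F : PointedCone ℚ (κ → ℚ), F.IsFaceOf μ → (∑ φ ∈ Φ, lam φ • bary φ) ∈ F → F = μ := by
  classical
  have hμΦ : μ ∈ Φ := hμ.1
  have hμΔ : μ ∈ Δ.cones := hΦ (Finset.mem_coe.mpr hμΦ)
  have hle : ∀ φ ∈ Φ, φ ≤ μ := fun φ hφ => le_of_maximal_of_isChain hch hμ hφ
  have hsplit : ∑ φ ∈ Φ, lam φ • bary φ = lam μ • bary μ + ∑ φ ∈ Φ.erase μ, lam φ • bary φ := by
    rw [← Finset.add_sum_erase Φ (fun θ => lam θ • bary θ) hμΦ]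
  have hy : ∑ φ ∈ Φ.erase μ, lam φ • bary φ ∈ μ :=
    μ.sum_mem fun φ hφ => smul_mem_of_nonneg
      (hle φ (Finset.mem_of_mem_erase hφ) (bary_mem (Δ.fg (hΦ (Finset.mem_coe.mpr (Finset.mem_of_mem_erase hφ))))))
      (hlam φ (Finset.mem_of_mem_erase hφ)).le
  refine ⟨?_, fun F hF hxF => ?_⟩
  · rw [hsplit]; exact μ.add_mem (smul_mem_of_nonneg (bary_mem (Δ.fg hμΔ)) (hlam μ hμΦ).le) hy
  · rw [hsplit] at hxF
    exact eq_of_isFaceOf_of_rep_mem hΔ hμΔ hy (hlam μ hμΦ) hF hxF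

/-- **A positive barycentric combination over a chain lying in a cone `τ` of the fan has all
its members below `τ`** (the top lies in no proper face, so `τ ∩ top = top`).
[cite: KempfEtAl1973, II §2] -/
theorem chain_le_of_rep_mem {Δ : Fan ℚ (κ → ℚ)} (hΔ : Δ.IsRational)
    {Φ : Finset (PointedCone ℚ (κ → ℚ))} (hΦ : (↑Φ : Set (PointedCone ℚ (κ → ℚ))) ⊆ Δ.cones)
    (hch : IsChain (· ≤ ·) (Φ : Set (PointedCone ℚ (κ → ℚ)))) {lam : PointedCone ℚ (κ → ℚ) → ℚ}
    (hlam : ∀ φ ∈ Φ, 0 < lam φ) {τ : PointedCone ℚ (κ → ℚ)} (hτ : τ ∈ Δ.cones)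
    (hx : (∑ φ ∈ Φ, lam φ • bary φ) ∈ τ) : ∀ φ ∈ Φ, φ ≤ τ := by
  rcases Φ.eq_empty_or_nonempty with rfl | hne
  · simp
  obtain ⟨μ, hμ⟩ := Finset.exists_maximal hne
  obtain ⟨hxμ, hnf⟩ := rep_mem_top_noProperFace hΔ hΦ hch hlam hμ
  have hμΔ : μ ∈ Δ.cones := hΦ (Finset.mem_coe.mpr hμ.1)
  have hface : (μ ⊓ τ).IsFaceOf μ := Δ.inf_isFaceOf hμΔ hτ
  have heq := hnf _ hface (Submodule.mem_inf.mpr ⟨hxμ, hx⟩)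
  have hμτ : μ ≤ τ := fun z hz => (Submodule.mem_inf.mp (heq.symm ▸ hz : z ∈ μ ⊓ τ)).2
  exact fun φ hφ => (le_of_maximal_of_isChain hch hμ hφ).trans hμτ

/-- **Comparable cones of a fan with spans of equal dimension are equal** (a proper face has
smaller dimension). [cite: Fulton1993Toric, §1.2 p. 10] -/
theorem eq_of_le_of_finrank_span_eq [Fintype κ] {Δ : Fan ℚ (κ → ℚ)} {φ ψ : PointedCone ℚ (κ → ℚ)}
    (hφ : φ ∈ Δ.cones) (hψ : ψ ∈ Δ.cones) (hle : φ ≤ ψ)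
    (hdim : Module.finrank ℚ (Submodule.span ℚ (φ : Set (κ → ℚ))) =
      Module.finrank ℚ (Submodule.span ℚ (ψ : Set (κ → ℚ)))) : φ = ψ := by
  by_contra hne
  exact absurd hdim (ne_of_lt (finrank_span_lt_of_isFaceOf_ne (Δ.isFaceOf_of_le hψ hφ hle) hne))

/-- In a chain of cones of a fan, members with spans of equal dimension are equal.
[cite: KempfEtAl1973, II §2] -/
theorem eq_of_isChain_of_finrank_span_eq [Fintype κ] {Δ : Fan ℚ (κ → ℚ)}
    {Ψ : Finset (PointedCone ℚ (κ → ℚ))} (hΨ : (↑Ψ : Set (PointedCone ℚ (κ → ℚ))) ⊆ Δ.cones)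
    (hch : IsChain (· ≤ ·) (Ψ : Set (PointedCone ℚ (κ → ℚ)))) {φ ψ : PointedCone ℚ (κ → ℚ)}
    (hφ : φ ∈ Ψ) (hψ : ψ ∈ Ψ)
    (hdim : Module.finrank ℚ (Submodule.span ℚ (φ : Set (κ → ℚ))) =
      Module.finrank ℚ (Submodule.span ℚ (ψ : Set (κ → ℚ)))) : φ = ψ := by
  by_contra hne
  rcases hch (Finset.mem_coe.mpr hφ) (Finset.mem_coe.mpr hψ) hne with h | h
  · exact hne (eq_of_le_of_finrank_span_eq (hΨ (Finset.mem_coe.mpr hφ)) (hΨ (Finset.mem_coe.mpr hψ)) h hdim)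
  · exact hne (eq_of_le_of_finrank_span_eq (hΨ (Finset.mem_coe.mpr hψ)) (hΨ (Finset.mem_coe.mpr hφ)) h hdim.symm).symm

/-! ## Parallelotope points and faces -/

/-- **A parallelotope point passes to the face cut out by a cone containing it.** Let `σ` be a
cone of the fan with primitive simplicial generators `S` and `z = Σ a_s s` a parallelotope point
(`a ∈ parCoeffs S`). If `z` lies in the cone `κ` of the fan, then on the face `F = σ ∩ κ` the
generators `S ∩ F` are primitive simplicial generators, `a` vanishes off them, and `z` is a
parallelotope point of `F`. [cite: Fulton1993Toric, §2.6 p. 48] -/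
theorem parPoint_face {Δ : Fan ℚ (κ → ℚ)} {σ κ' : PointedCone ℚ (κ → ℚ)} [DecidablePred (· ∈ σ ⊓ κ')]
    (hσ : σ ∈ Δ.cones) (hκ : κ' ∈ Δ.cones) {S : Finset (κ → ℚ)} (hS : IsPrimGens σ S)
    {a : (κ → ℚ) → ℚ} (ha : a ∈ parCoeffs S) (hz : ∑ s ∈ S, a s • s ∈ κ') :
    IsPrimGens (σ ⊓ κ') (S.filter (· ∈ σ ⊓ κ')) ∧ a ∈ parCoeffs (S.filter (· ∈ σ ⊓ κ')) ∧
      ∑ s ∈ S.filter (· ∈ σ ⊓ κ'), a s • s = ∑ s ∈ S, a s • s := by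
  haveI : DecidableEq (κ → ℚ) := Classical.decEq _
  have hface : (σ ⊓ κ').IsFaceOf σ := Δ.inf_isFaceOf hσ hκ
  obtain ⟨hprim, hli, hσS⟩ := hS
  have hface' : (σ ⊓ κ').IsFaceOf (PointedCone.hull ℚ (S : Set (κ → ℚ))) := hσS ▸ hface
  have hFeq : σ ⊓ κ' = PointedCone.hull ℚ ((S.filter (· ∈ σ ⊓ κ') : Finset (κ → ℚ)) : Set (κ → ℚ)) :=
    eq_hull_filter_of_isFaceOf_hull hface'
  -- `z ∈ σ ⊓ κ'`, so every generator with positive coefficient lies in it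
  have hzσ : ∑ s ∈ S, a s • s ∈ σ := hσS ▸ sum_smul_mem_hull fun s hs => (ha.1 s hs).1
  have hzF : ∑ s ∈ S, a s • s ∈ σ ⊓ κ' := Submodule.mem_inf.mpr ⟨hzσ, hz⟩
  have hmemF : ∀ s ∈ S, a s ≠ 0 → s ∈ σ ⊓ κ' := by
    intro s hs has
    have hpos : 0 < a s := lt_of_le_of_ne (ha.1 s hs).1 (Ne.symm has)
    have hsplit : ∑ t ∈ S, a t • t = a s • s + ∑ t ∈ S.erase s, a t • t := by
      rw [← Finset.add_sum_erase S (fun t => a t • t) hs]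
    have hrest : ∑ t ∈ S.erase s, a t • t ∈ σ :=
      σ.sum_mem fun t ht => smul_mem_of_nonneg
        (hσS ▸ PointedCone.subset_hull (Finset.mem_coe.mpr (Finset.mem_of_mem_erase ht)))
        (ha.1 t (Finset.mem_of_mem_erase ht)).1
    have hsσ : s ∈ σ := hσS ▸ PointedCone.subset_hull (Finset.mem_coe.mpr hs)
    exact hface.mem_of_smul_add_mem hsσ hrest hpos (hsplit ▸ hzF)
  -- the sum over the generators in the face is the whole sum
  have hsum : ∑ s ∈ S.filter (· ∈ σ ⊓ κ'), a s • s = ∑ s ∈ S, a s • s := by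
    rw [Finset.sum_filter]
    refine Finset.sum_congr rfl fun s hs => ?_
    split_ifs with h
    · rfl
    · have : a s = 0 := by by_contra has; exact h (hmemF s hs has)
      rw [this, zero_smul]
  refine ⟨⟨fun s hs => hprim s (Finset.mem_filter.mp hs).1, ?_, hFeq⟩,
    ⟨fun s hs => ha.1 s (Finset.mem_filter.mp hs).1, fun s hs => ?_, ?_⟩, hsum⟩
  · rw [Finset.coe_filter]
    exact hli.mono fun s hs => hs.1
  · by_cases hsS : s ∈ S
    · by_contra has
      exact hs (Finset.mem_filter.mpr ⟨hsS, hmemF s hsS has⟩)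
    · exact ha.2.1 s hsS
  · rw [hsum]; exact ha.2.2

/-! ## The orbit theorem -/

/-- **Orbits of a parallelotope point under the links of a family** ([KempfEtAl1973] II §2: the
images of the chosen lattice point under all chart changes). For a family of rational fans `Δ₀ i`
with family links `L`, refinements `Δ i` of the flag fans (every cone inside
a flag cone of a chain of nonzero cones of `Δ₀ i`, covering every cone of `Δ₀ i`, compatible with
every link in both directions) and a primitive parallelotope point `w` of a cone of `Δ i₀`, there
are finite sets `Z i` with `w ∈ Z i₀`, closed under every link and its inverse, consisting of
primitive parallelotope points of cones of `Δ i`, no cone of `Δ i` containing two of them.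
(`Z i` = the primitive parallelotope points of member `i` having the flag type of `w`.)
[cite: KempfEtAl1973, Ch. II §2 Thm. 11*] -/
theorem exists_orbit {ι : Type} [Fintype ι] {n : ι → ℕ} (Δ₀ : ∀ i, Fan ℚ (Fin (n i) → ℚ))
    (hΔ₀ : ∀ i, (Δ₀ i).IsRational) (L : Set (Fan.FamilyLink n Δ₀))
    (Δ : ∀ i, Fan ℚ (Fin (n i) → ℚ))
    (hflag : ∀ i, ∀ κ ∈ (Δ i).cones, ∃ Ψ : Finset (PointedCone ℚ (Fin (n i) → ℚ)),
      (↑Ψ ⊆ (Δ₀ i).cones) ∧ ⊥ ∉ Ψ ∧ IsChain (· ≤ ·) (Ψ : Set (PointedCone ℚ (Fin (n i) → ℚ))) ∧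
      κ ≤ flagCone (Ψ : Set (PointedCone ℚ (Fin (n i) → ℚ))))
    (hcover : ∀ i, ∀ σ ∈ (Δ₀ i).cones, (σ : Set (Fin (n i) → ℚ)) ⊆ ((Δ i).restrict σ).support)
    (hcompat : ∀ ℓ ∈ L, Fan.FamilyLinkCompatible Δ ℓ ∧ Fan.FamilyLinkCompatible Δ ℓ.symm)
    {i₀ : ι} {w : Fin (n i₀) → ℚ} (hw : IsPrimitive w)
    (hwpar : ∃ σ ∈ (Δ i₀).cones, ∃ S : Finset (Fin (n i₀) → ℚ), IsPrimGens σ S ∧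
      ∃ a ∈ parCoeffs S, w = ∑ s ∈ S, a s • s) :
    ∃ Z : ∀ i, Finset (Fin (n i) → ℚ),
      w ∈ Z i₀ ∧
      (∀ ℓ ∈ L, (∀ z ∈ Z ℓ.i, z ∈ ℓ.src → ℓ.toLin z ∈ Z ℓ.j) ∧
        (∀ z ∈ Z ℓ.j, z ∈ ℓ.tgt → ℓ.invLin z ∈ Z ℓ.i)) ∧
      (∀ i, ∀ z ∈ Z i, IsPrimitive z ∧ ∃ σ ∈ (Δ i).cones, ∃ S : Finset (Fin (n i) → ℚ),
        IsPrimGens σ S ∧ ∃ a ∈ parCoeffs S, z = ∑ s ∈ S, a s • s) ∧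
      (∀ i, ∀ κ ∈ (Δ i).cones, ∀ z ∈ Z i, ∀ z' ∈ Z i, z ∈ κ → z' ∈ κ → z = z') := by
  classical
  -- dimensions
  let dimf : ∀ i, PointedCone ℚ (Fin (n i) → ℚ) → ℕ := fun i φ =>
    Module.finrank ℚ (Submodule.span ℚ (φ : Set (Fin (n i) → ℚ)))
  -- the seed's flag representation
  obtain ⟨σw, hσw, Sw, hSw, aw, haw, hweq⟩ := hwpar
  have hwσ : w ∈ σw := by rw [hweq, hSw.2.2]; exact sum_smul_mem_hull fun s hs => (haw.1 s hs).1
  obtain ⟨Ψ₀, hΨ₀, hΨ₀0, hΨ₀ch, hσΨ₀⟩ := hflag i₀ σw hσw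
  have hwflag : w ∈ (⊥ : PointedCone ℚ (Fin (n i₀) → ℚ)) ⊔ flagCone (Ψ₀ : Set _) := by
    rw [bot_sup_eq]; exact hσΨ₀ hwσ
  obtain ⟨r, hr, mu, hmu, hwr⟩ := exists_rep_of_mem_sup_flagCone (hΔ₀ i₀) hΨ₀ hwflag
  have hr0 : r = 0 := (Submodule.mem_bot ℚ).mp hr
  set Φw := Ψ₀.filter (fun φ => 0 < mu φ) with hΦw
  have hΦwΨ : Φw ⊆ Ψ₀ := Finset.filter_subset _ _
  have hΦwc : (↑Φw : Set (PointedCone ℚ (Fin (n i₀) → ℚ))) ⊆ (Δ₀ i₀).cones := fun φ hφ =>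
    hΨ₀ (Finset.mem_coe.mpr (hΦwΨ (Finset.mem_coe.mp hφ)))
  have hΦwch : IsChain (· ≤ ·) (↑Φw : Set (PointedCone ℚ (Fin (n i₀) → ℚ))) :=
    hΨ₀ch.mono fun φ hφ => Finset.mem_coe.mpr (hΦwΨ (Finset.mem_coe.mp hφ))
  have hwrep : w = ∑ φ ∈ Φw, mu φ • bary φ := by
    rw [hwr, hr0, zero_add, hΦw, sum_filter_pos_eq hmu]
  -- the type: coefficient by dimension
  set Dw : Finset ℕ := Φw.image (dimf i₀) with hDw
  let c : ℕ → ℚ := fun d => if h : ∃ φ ∈ Φw, dimf i₀ φ = d then mu h.choose else 0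
  have hc : ∀ φ ∈ Φw, c (dimf i₀ φ) = mu φ := by
    intro φ hφ
    have hex : ∃ φ' ∈ Φw, dimf i₀ φ' = dimf i₀ φ := ⟨φ, hφ, rfl⟩
    have h1 : c (dimf i₀ φ) = mu hex.choose := by simp only [c, dif_pos hex]
    rw [h1]
    obtain ⟨hφ', hd⟩ := hex.choose_spec
    rw [eq_of_isChain_of_finrank_span_eq hΦwc hΦwch hφ' hφ hd]
  have hcpos : ∀ d ∈ Dw, 0 < c d := by
    intro d hd
    obtain ⟨φ, hφ, rfl⟩ := Finset.mem_image.mp hd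
    rw [hc φ hφ]; exact (Finset.mem_filter.mp hφ).2
  -- the three link-invariant predicates
  let SameType : ∀ i, (Fin (n i) → ℚ) → Prop := fun i z =>
    ∃ Φ : Finset (PointedCone ℚ (Fin (n i) → ℚ)), (↑Φ ⊆ (Δ₀ i).cones) ∧ ⊥ ∉ Φ ∧
      IsChain (· ≤ ·) (Φ : Set (PointedCone ℚ (Fin (n i) → ℚ))) ∧ Φ.image (dimf i) = Dw ∧
      z = ∑ φ ∈ Φ, c (dimf i φ) • bary φ
  let ParPt : ∀ i, (Fin (n i) → ℚ) → Prop := fun i z =>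
    ∃ σ ∈ (Δ i).cones, ∃ S : Finset (Fin (n i) → ℚ), IsPrimGens σ S ∧
      ∃ a ∈ parCoeffs S, z = ∑ s ∈ S, a s • s
  -- positivity of the coefficients of a same-type representation
  have hlam : ∀ {i} {Φ : Finset (PointedCone ℚ (Fin (n i) → ℚ))}, Φ.image (dimf i) = Dw →
      ∀ φ ∈ Φ, 0 < c (dimf i φ) := fun {i Φ} hD φ hφ =>
    hcpos _ (hD ▸ Finset.mem_image_of_mem _ hφ)
  -- the orbit sets
  refine ⟨fun i => (((Δ₀ i).finite.toFinset.powerset.image fun Φ => ∑ φ ∈ Φ, c (dimf i φ) • bary φ).filter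
      fun z => SameType i z ∧ IsPrimitive z ∧ ParPt i z), ?_, ?_, ?_, ?_⟩
  -- membership unfolded
  all_goals first
    | have hZ : ∀ i z, z ∈ (((Δ₀ i).finite.toFinset.powerset.image fun Φ =>
          ∑ φ ∈ Φ, c (dimf i φ) • bary φ).filter fun z => SameType i z ∧ IsPrimitive z ∧ ParPt i z) ↔
          SameType i z ∧ IsPrimitive z ∧ ParPt i z := by
        intro i z
        rw [Finset.mem_filter]
        constructor
        · exact fun h => h.2
        · rintro ⟨hst, hp, hpp⟩
          refine ⟨?_, hst, hp, hpp⟩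
          obtain ⟨Φ, hΦ, -, -, -, rfl⟩ := hst
          exact Finset.mem_image.mpr ⟨Φ, Finset.mem_powerset.mpr fun φ hφ =>
            (Δ₀ i).finite.mem_toFinset.mpr (hΦ (Finset.mem_coe.mpr hφ)), rfl⟩
  · -- the seed
    rw [hZ]
    refine ⟨⟨Φw, hΦwc, fun h0 => hΨ₀0 (hΦwΨ h0), hΦwch, rfl, ?_⟩, hw,
      ⟨σw, hσw, Sw, hSw, aw, haw, hweq⟩⟩
    rw [hwrep]
    exact Finset.sum_congr rfl fun φ hφ => by rw [hc φ hφ]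
  · -- closure under the links: one step for an arbitrary two-sided compatible link
    have step : ∀ ℓ : Fan.FamilyLink n Δ₀,
        Fan.FamilyLinkCompatible Δ ℓ ∧ Fan.FamilyLinkCompatible Δ ℓ.symm →
        ∀ z, SameType ℓ.i z ∧ IsPrimitive z ∧ ParPt ℓ.i z → z ∈ ℓ.src →
          SameType ℓ.j (ℓ.toLin z) ∧ IsPrimitive (ℓ.toLin z) ∧ ParPt ℓ.j (ℓ.toLin z) := by
      intro ℓ hℓc z ⟨⟨Φ, hΦ, hΦ0, hΦch, hΦD, hzΦ⟩, hzp, ⟨σ, hσ, S, hS, a, ha, hza⟩⟩ hzsrc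
      have hinj := ℓ.eq_zero_of_toLin_eq_zero
      have hlat := ℓ.integral_span hΔ₀
      have hlat' := ℓ.exists_latticeN_preimage hΔ₀
      set U := Submodule.span ℚ (ℓ.src : Set (Fin (n ℓ.i) → ℚ)) with hU
      have hzU : z ∈ U := Submodule.subset_span hzsrc
      have hpos : ∀ φ ∈ Φ, 0 < c (dimf ℓ.i φ) := hlam hΦD
      -- the chain lies below `src`
      have hΦsrc : ∀ φ ∈ Φ, φ ≤ ℓ.src :=
        chain_le_of_rep_mem (hΔ₀ ℓ.i) hΦ hΦch hpos ℓ.src_mem (hzΦ ▸ hzsrc)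
      have hΦU : ∀ φ ∈ Φ, (φ : Set (Fin (n ℓ.i) → ℚ)) ⊆ U := fun φ hφ x hx =>
        Submodule.subset_span (hΦsrc φ hφ hx)
      refine ⟨?_, isPrimitive_map hinj hlat hlat' hzU hzp, ?_⟩
      · -- same type: transport the chain
        have hmapinj : ∀ φ ∈ Φ, ∀ ψ ∈ Φ, φ.map ℓ.toLin = ψ.map ℓ.toLin → φ = ψ := fun φ hφ ψ hψ h =>
          (map_eq_map_iff_of_subset hinj (hΦU φ hφ) (hΦU ψ hψ)).mp h
        have hdim : ∀ φ ∈ Φ, dimf ℓ.j (φ.map ℓ.toLin) = dimf ℓ.i φ := fun φ hφ =>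
          finrank_span_map_of_subset hinj (hΦU φ hφ)
        refine ⟨Φ.image fun φ => φ.map ℓ.toLin, ?_, ?_, ?_, ?_, ?_⟩
        · intro ψ hψ
          obtain ⟨φ, hφ, rfl⟩ := Finset.mem_image.mp (Finset.mem_coe.mp hψ)
          exact ℓ.map_mem_cones_of_le (hΦ (Finset.mem_coe.mpr hφ)) (hΦsrc φ hφ)
        · intro h0
          obtain ⟨φ, hφ, hφ0⟩ := Finset.mem_image.mp h0
          have : φ = ⊥ := (map_eq_map_iff_of_subset hinj (hΦU φ hφ) (by simp)).mp (by rw [hφ0, map_bot])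
          exact hΦ0 (this ▸ hφ)
        · rw [Finset.coe_image]; exact isChain_image_map ℓ.toLin hΦch
        · rw [Finset.image_image, ← hΦD]
          refine Finset.image_congr fun φ hφ => ?_
          simp only [Function.comp_apply]
          exact hdim φ (Finset.mem_coe.mp hφ)
        · rw [Finset.sum_image fun φ hφ ψ hψ h => hmapinj φ hφ ψ hψ h, hzΦ, map_sum]
          refine Finset.sum_congr rfl fun φ hφ => ?_
          rw [map_smul, hdim φ hφ, ℓ.bary_map hΔ₀ (hΦ (Finset.mem_coe.mpr hφ)) (hΦsrc φ hφ)]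
      · -- parallelotope point: pass to the face cut out by a cone of `Δ i` inside `src`, transport
        obtain ⟨κ', hκ', hzκ'⟩ := Fan.mem_support.mp (hcover ℓ.i ℓ.src ℓ.src_mem hzsrc)
        have hzκ : ∑ s ∈ S, a s • s ∈ κ' := hza ▸ hzκ'
        obtain ⟨hS', ha', hsum'⟩ := parPoint_face hσ hκ'.1 hS ha hzκ
        set S' := S.filter (· ∈ σ ⊓ κ') with hS'def
        have hFmem : σ ⊓ κ' ∈ (Δ ℓ.i).cones := (Δ ℓ.i).face_mem hσ ((Δ ℓ.i).inf_isFaceOf hσ hκ'.1)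
        have hFsrc : σ ⊓ κ' ≤ ℓ.src := inf_le_right.trans hκ'.2
        have hFU : ((σ ⊓ κ' : PointedCone ℚ _) : Set (Fin (n ℓ.i) → ℚ)) ⊆ U := fun x hx =>
          Submodule.subset_span (hFsrc hx)
        have hS'U : (↑S' : Set (Fin (n ℓ.i) → ℚ)) ⊆ U := fun x hx =>
          hFU (hS'.2.2 ▸ PointedCone.subset_hull hx)
        have hmap : (σ ⊓ κ').map ℓ.toLin ∈ (Δ ℓ.j).cones := (hℓc.1 _ ⟨hFmem, hFsrc⟩).1
        have hS'map : IsPrimGens ((σ ⊓ κ').map ℓ.toLin) (S'.image ℓ.toLin) :=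
          isPrimGens_map hinj hlat hlat' hFU hS'
        have hpar := parCoeffs_image_eq hinj hlat hlat' hS'U
        rw [hpar] at ha'
        obtain ⟨a', ha'mem, hapull⟩ := ha'
        refine ⟨_, hmap, _, hS'map, a', ha'mem, ?_⟩
        rw [hza, ← hsum', map_sum, Finset.sum_image fun s hs t ht h =>
          eq_of_map_eq_of_mem hinj (hS'U (Finset.mem_coe.mpr hs)) (hS'U (Finset.mem_coe.mpr ht)) h]
        refine Finset.sum_congr rfl fun s hs => ?_
        rw [map_smul, ← hapull]
        simp only [if_pos hs]
    intro ℓ hℓ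
    refine ⟨fun z hz hzs => ?_, fun z hz hzt => ?_⟩
    · rw [hZ] at hz ⊢
      exact step ℓ (hcompat ℓ hℓ) z hz hzs
    · rw [hZ] at hz ⊢
      have hsymm : Fan.FamilyLinkCompatible Δ ℓ.symm ∧ Fan.FamilyLinkCompatible Δ ℓ.symm.symm :=
        ⟨(hcompat ℓ hℓ).2, (hcompat ℓ hℓ).1⟩
      exact step ℓ.symm hsymm z hz hzt
  · -- every orbit point is a primitive parallelotope point
    intro i z hz
    rw [hZ] at hz
    exact ⟨hz.2.1, hz.2.2⟩
  · -- separation: the type pins a point down inside a flag cone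
    intro i κ' hκ' z hz z' hz' hzκ hz'κ
    rw [hZ] at hz hz'
    obtain ⟨⟨Φ, hΦ, hΦ0, hΦch, hΦD, rfl⟩, -, -⟩ := hz
    obtain ⟨⟨Φ', hΦ', hΦ'0, hΦ'ch, hΦ'D, rfl⟩, -, -⟩ := hz'
    obtain ⟨Ψ, hΨ, hΨ0, hΨch, hκΨ⟩ := hflag i κ' hκ'
    have h1 : Φ ⊆ Ψ := chain_subset_of_mem_flagCone (hΔ₀ i) hΦ hΦ0 hΦch hΨ hΨ0 hΨch (hlam hΦD) (hκΨ hzκ)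
    have h2 : Φ' ⊆ Ψ := chain_subset_of_mem_flagCone (hΔ₀ i) hΦ' hΦ'0 hΦ'ch hΨ hΨ0 hΨch (hlam hΦ'D) (hκΨ hz'κ)
    have hsub : ∀ {A B : Finset (PointedCone ℚ (Fin (n i) → ℚ))}, A ⊆ Ψ → B ⊆ Ψ →
        A.image (dimf i) = Dw → B.image (dimf i) = Dw → A ⊆ B := by
      intro A B hA hB hAD hBD φ hφ
      have hd : dimf i φ ∈ B.image (dimf i) := by rw [hBD, ← hAD]; exact Finset.mem_image_of_mem _ hφ
      obtain ⟨ψ, hψ, hψd⟩ := Finset.mem_image.mp hd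
      rw [eq_of_isChain_of_finrank_span_eq hΨ hΨch (hA hφ) (hB hψ) hψd.symm]; exact hψ
    have heq : Φ = Φ' := Finset.Subset.antisymm (hsub h1 h2 hΦD hΦ'D) (hsub h2 h1 hΦ'D hΦD)
    rw [heq]

/-- **The orbit lists feed the compatibility lemma.** For link-closed finite sets `Z i` of
primitive vectors (e.g. the output of `Fan.exists_orbit`), the enumerations `(Z i).toList` satisfy
exactly the hypotheses `hli`, `hlj`, `hndi`, `hndj`, `hclosed` of
`Fan.familyLinkCompatible_starIter` (res-lit-3, `LinkBridge.lean`) for every link of `L`.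
[cite: KempfEtAl1973, Ch. II §2 Thm. 4*] -/
theorem orbit_toList_closed {ι : Type} {n : ι → ℕ} {Δ₀ : ∀ i, Fan ℚ (Fin (n i) → ℚ)}
    {L : Set (Fan.FamilyLink n Δ₀)} {Z : ∀ i, Finset (Fin (n i) → ℚ)}
    (hcl : ∀ ℓ ∈ L, (∀ z ∈ Z ℓ.i, z ∈ ℓ.src → ℓ.toLin z ∈ Z ℓ.j) ∧
      (∀ z ∈ Z ℓ.j, z ∈ ℓ.tgt → ℓ.invLin z ∈ Z ℓ.i))
    (hprim : ∀ i, ∀ z ∈ Z i, IsPrimitive z) {ℓ : Fan.FamilyLink n Δ₀} (hℓ : ℓ ∈ L) :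
    (∀ z ∈ (Z ℓ.i).toList, z ≠ 0) ∧ (∀ w ∈ (Z ℓ.j).toList, w ≠ 0) ∧
      (Z ℓ.i).toList.Nodup ∧ (Z ℓ.j).toList.Nodup ∧
      ∀ w, w ∈ (Z ℓ.j).toList ∧ w ∈ ℓ.tgt ↔ ∃ z ∈ (Z ℓ.i).toList, z ∈ ℓ.src ∧ ℓ.toLin z = w := by
  refine ⟨fun z hz => (hprim _ z (Finset.mem_toList.mp hz)).2.1,
    fun w hw => (hprim _ w (Finset.mem_toList.mp hw)).2.1, Finset.nodup_toList _, Finset.nodup_toList _,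
    fun w => ⟨?_, ?_⟩⟩
  · rintro ⟨hw, hwt⟩
    refine ⟨ℓ.invLin w, Finset.mem_toList.mpr ((hcl ℓ hℓ).2 w (Finset.mem_toList.mp hw) hwt),
      ℓ.mapsTo_inv w hwt, ℓ.right_inv w hwt⟩
  · rintro ⟨z, hz, hzs, rfl⟩
    exact ⟨Finset.mem_toList.mpr ((hcl ℓ hℓ).1 z (Finset.mem_toList.mp hz) hzs), ℓ.mapsTo z hzs⟩

/-- The orbit points are separated member by member, in list form (hypothesis `hsep` of
`Fan.familyLinkCompatible_starIter` and of `IsOrdFunction.multiStar`).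
[cite: KempfEtAl1973, Ch. II §2 Thm. 11*] -/
theorem orbit_toList_separated {ι : Type} {n : ι → ℕ} {Δ : ∀ i, Fan ℚ (Fin (n i) → ℚ)}
    {Z : ∀ i, Finset (Fin (n i) → ℚ)}
    (hsep : ∀ i, ∀ κ ∈ (Δ i).cones, ∀ z ∈ Z i, ∀ z' ∈ Z i, z ∈ κ → z' ∈ κ → z = z') (i : ι) :
    ∀ σ ∈ (Δ i).cones, ∀ z ∈ (Z i).toList, ∀ z' ∈ (Z i).toList, z ∈ σ → z' ∈ σ → z = z' :=
  fun σ hσ z hz z' hz' => hsep i σ hσ z (Finset.mem_toList.mp hz) z' (Finset.mem_toList.mp hz')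

end Fan

end Literature.Geometry.PolyhedralFans

end
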